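import Summits.QuantumFields.YangMills.Theorems.ComplexCouplingChannelTubeZeroFreeChannelStubTubeRate
import Literature.MathematicalPhysics.QuantumLattice.LatticeGaugeDLRFreeEnergyProofs
import HarnessLib

/-!
# Tube rates converge to the torus free energy density (stub W2 of line `legendre-capped-pocket`)

Helper file for the crux `TubeZeroFreeChannel` (item `stmt-QuantumFields-18841`, route
`ComplexCouplingChannel` of `QuantumFields/YangMills`), line `legendre-capped-pocket`, stub W2
(`stub_tubeRateLimit`).  For every admissible `(G, r)` (compact `G`, faithful continuous unitary `r`)
and every real coupling `x ≥ 0`, the TUBE RATES `log λ₊(x, P) / P³` — `λ₊ = transferSpectralRadius r.ρ x P`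
the principal growth rate (top eigenvalue = operator norm) of Lüscher's transfer matrix on the spatial
torus `(ℤ/P)³` — converge, as `P → ∞`, to the TORUS free energy density `freeEnergyDensity 4 r.ρ x` of
`LatticeGaugeDLR` (which exists: `exists_hasFreeEnergyDensity_holds`).

Proof (no thermodynamic-limit or tiling work: read the symmetric torus `P⁴` as a tube of cross-section
`P` and length `P`).  Fix `P ≥ 2` and let `Z_t = wilsonFinTorusPartition r.ρ x P P P t` and
`0 ≤ λᵢ ≤ λ₊`, `0 < λ₊`, the eigen-data of the transfer matrix, so that `Z_t = Σᵢ λᵢ^t` for `t ≥ 2`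
(trace formula `exists_spectralData_wilsonFinTorusPartition`).  Then
`λ₊^P ≤ Z_P ≤ λ₊^{P-2} Z_2` and `Z_3 ≤ λ₊ Z_2`, whence
`0 ≤ log Z_P − P log λ₊ ≤ log Z_2 − 2 log λ₊ ≤ 3 log Z_2 − 2 log Z_3 ≤ 72 |x| M P³`
by the volume bounds `Z_2 ≤ e^{12 |x| M P³}`, `Z_3 ≥ e^{−18 |x| M P³}` (`M = costBound r.ρ`;
`norm_boxZ_le`, `boxZ_ofReal` of `AxisBlocking` through the dictionary
`boxZ r x a t = wilsonFinTorusPartition r.ρ x a a a t` of the landed stub-W1 file,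
`boxZ_ofReal_eq_wilsonFinTorusPartition`).  Dividing by `P⁴`,
`|P⁻⁴ log Z_P − P⁻³ log λ₊| ≤ 72 |x| M / P → 0`, and `P⁻⁴ log Z_P → freeEnergyDensity 4 r.ρ x` is
`HasFreeEnergyDensity` read through `toReal_partitionFunction_eq_wilsonFinTorusPartition`.

References: M. Lüscher, Commun. Math. Phys. 54 (1977) 283 (transfer matrix); I. Montvay, G. Münster,
*Quantum Fields on a Lattice* (1994) §3.2.6 (3.145) (`Z = Tr 𝕋ⁿ`); S. Friedli, Y. Velenik,
*Statistical Mechanics of Lattice Systems* (2017) Thm. 3.6 (existence of the pressure).  Everything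
below is standard and tagged folklore.
-/

set_option autoImplicit false

noncomputable section

open Filter Topology
open Literature.MathematicalPhysics.QuantumFieldTheory (LatticeRep transferSpectralRadius
  wilsonFinTorusPartition exists_spectralData_wilsonFinTorusPartition wilsonFinTorusPartition_pos
  toReal_partitionFunction_eq_wilsonFinTorusPartition costBound costBound_pos)
open Literature.MathematicalPhysics.QuantumLattice (freeEnergyDensity HasFreeEnergyDensity
  torusLogPartition hasFreeEnergyDensity_freeEnergyDensity exists_hasFreeEnergyDensity_holds)
open Summit.QuantumFields.YangMills.Theorems.TubeZeroFreeChannel.Negative (boxZ norm_boxZ_le boxZ_ofReal)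

namespace Summit.QuantumFields.YangMills.Theorems.TubeZeroFreeChannel

/-! ### The elementary eigenvalue estimate -/

/-- **Trace versus top eigenvalue.**  For non-negative `λᵢ ≤ λ_{i₀}`, `0 < λ_{i₀}`, with
`Z (m+2) = Σᵢ λᵢ^{m+2}` for all `m`, `Z > 0`, and the a-priori bounds `log Z 2 ≤ 12 K`,
`log Z 3 ≥ -18 K` (`K ≥ 0`): `|log Z (m+2) − (m+2) log λ_{i₀}| ≤ 72 K`.  Indeed
`λ_{i₀}^{m+2} ≤ Z (m+2) ≤ λ_{i₀}^m Z 2` and `Z 3 ≤ λ_{i₀} Z 2`. [folklore] -/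
private theorem abs_log_sub_le_of_hasSum {ι : Type*} {lam : ι → ℝ} {i₀ : ι} {Z : ℕ → ℝ} {K : ℝ}
    (hle : ∀ i, 0 ≤ lam i ∧ lam i ≤ lam i₀) (hpos : 0 < lam i₀)
    (hZ : ∀ m, HasSum (fun i => lam i ^ (m + 2)) (Z (m + 2))) (hZpos : ∀ t, 0 < Z t) (hK : 0 ≤ K)
    (h2 : Real.log (Z 2) ≤ 12 * K) (h3 : -(18 * K) ≤ Real.log (Z 3)) (m : ℕ) :
    |Real.log (Z (m + 2)) - ((m + 2 : ℕ) : ℝ) * Real.log (lam i₀)| ≤ 72 * K := by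
  have hZ2 : HasSum (fun i => lam i ^ 2) (Z 2) := by simpa using hZ 0
  have hZ3 : HasSum (fun i => lam i ^ 3) (Z 3) := by simpa using hZ 1
  -- the three eigenvalue inequalities
  have i1 : lam i₀ ^ (m + 2) ≤ Z (m + 2) := le_hasSum (hZ m) i₀ fun j _ => pow_nonneg (hle j).1 _
  have i2 : Z (m + 2) ≤ lam i₀ ^ m * Z 2 := by
    refine hasSum_le (fun i => ?_) (hZ m) (hZ2.mul_left (lam i₀ ^ m))
    rw [pow_add]
    exact mul_le_mul_of_nonneg_right (pow_le_pow_left₀ (hle i).1 (hle i).2 m) (sq_nonneg _)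
  have i3 : Z 3 ≤ lam i₀ * Z 2 := by
    refine hasSum_le (fun i => ?_) hZ3 (hZ2.mul_left (lam i₀))
    calc lam i ^ 3 = lam i * lam i ^ 2 := by ring
      _ ≤ lam i₀ * lam i ^ 2 := mul_le_mul_of_nonneg_right (hle i).2 (sq_nonneg _)
  -- their logarithms
  have l1 : ((m + 2 : ℕ) : ℝ) * Real.log (lam i₀) ≤ Real.log (Z (m + 2)) := by
    rw [← Real.log_pow]
    exact Real.log_le_log (pow_pos hpos _) i1
  have l2 : Real.log (Z (m + 2)) ≤ (m : ℝ) * Real.log (lam i₀) + Real.log (Z 2) := by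
    rw [← Real.log_pow, ← Real.log_mul (pow_pos hpos _).ne' (hZpos 2).ne']
    exact Real.log_le_log (hZpos _) i2
  have l3 : Real.log (Z 3) ≤ Real.log (lam i₀) + Real.log (Z 2) := by
    rw [← Real.log_mul hpos.ne' (hZpos 2).ne']
    exact Real.log_le_log (hZpos _) i3
  have e1 : ((m + 2 : ℕ) : ℝ) * Real.log (lam i₀) =
      (m : ℝ) * Real.log (lam i₀) + 2 * Real.log (lam i₀) := by
    push_cast
    ring
  rw [abs_le]
  constructor <;> linarith

/-! ### The gauge-theoretic estimate on the symmetric torus `P⁴` -/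

section Gauge

variable {G : Type} [Group G] [TopologicalSpace G] [IsTopologicalGroup G] [CompactSpace G]
  [MeasurableSpace G] [BorelSpace G] [SecondCountableTopology G]

/-- **The symmetric torus read as a tube**: for `x ≥ 0` and `P ≥ 2`,
`|log Z(x; P⁴) − P · log λ₊(x, P)| ≤ 72 |x| M P³` (`Z(x; P⁴) = wilsonFinTorusPartition r.ρ x P P P P`,
`λ₊ = transferSpectralRadius r.ρ x P`, `M = costBound r.ρ`): the trace formula
`exists_spectralData_wilsonFinTorusPartition` and the volume bounds `norm_boxZ_le`, `boxZ_ofReal`.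
[folklore] -/
theorem abs_log_torusPartition_sub_le (r : LatticeRep G) {x : ℝ} (hx : 0 ≤ x) (P : ℕ) [NeZero P]
    (hP : 2 ≤ P) :
    |Real.log (wilsonFinTorusPartition r.ρ x P P P P) -
        (P : ℝ) * Real.log (transferSpectralRadius r.ρ x P)| ≤
      72 * (|x| * (P : ℝ) ^ 3 * costBound r.ρ) := by
  obtain ⟨s, _, b, lam, i₀, -, hle, hpos, -, -, hrad, hZ⟩ :=
    exists_spectralData_wilsonFinTorusPartition (ρ := r.ρ) r.continuous r.mem_unitary hx P
  rw [hrad]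
  obtain ⟨m, rfl⟩ : ∃ m, P = m + 2 := ⟨P - 2, by omega⟩
  have hZpos : ∀ t, 0 < wilsonFinTorusPartition r.ρ x (m + 2) (m + 2) (m + 2) t := fun t =>
    wilsonFinTorusPartition_pos r.continuous x _ _ _ _
  have hc := costBound_pos r.ρ
  have hK : 0 ≤ |x| * ((m + 2 : ℕ) : ℝ) ^ 3 * costBound r.ρ := by positivity
  refine abs_log_sub_le_of_hasSum (Z := wilsonFinTorusPartition r.ρ x (m + 2) (m + 2) (m + 2))
    hle hpos hZ hZpos hK ?_ ?_ m
  · -- `log Z 2 ≤ 12 K` from `|Z(z; a, t)| ≤ exp(6 M |z| a³ t)`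
    have h := norm_boxZ_le r (x : ℂ) (m + 2) 2
    rw [norm_boxZ_ofReal, Complex.norm_real, Real.norm_eq_abs] at h
    rw [Real.log_le_iff_le_exp (hZpos 2)]
    refine h.trans (le_of_eq ?_)
    congr 1
    push_cast
    ring
  · -- `-18 K ≤ log Z 3` from `exp(-6 M |x| a³ t) ≤ Z(x; a, t)`
    obtain ⟨y, hy, hyZ⟩ := boxZ_ofReal r x (m + 2) 3
    rw [boxZ_ofReal_eq_wilsonFinTorusPartition, Complex.ofReal_inj] at hyZ
    rw [Real.le_log_iff_exp_le (hZpos 3), hyZ]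
    refine le_trans (le_of_eq ?_) hy
    congr 1
    push_cast
    ring

end Gauge

/-! ### The stub -/

/-- **STUB W2 `stub_tubeRateLimit` (line `legendre-capped-pocket` of crux `TubeZeroFreeChannel`): the
tube rates converge to the torus free energy density.**  For every compact `G`, every faithful
continuous unitary lattice representation `r` and every real coupling `x ≥ 0`,
`log λ₊(x, L+1) / (L+1)³ → freeEnergyDensity 4 r.ρ x` as `L → ∞`, where
`λ₊(x, P) = transferSpectralRadius r.ρ x P` is the principal growth rate of the transfer matrix on the
spatial torus `(ℤ/P)³`.  Proof: `|P⁻⁴ log Z(x; P⁴) − P⁻³ log λ₊(x, P)| ≤ 72 |x| M / P`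
(`abs_log_torusPartition_sub_le`) and `P⁻⁴ log Z(x; P⁴) → freeEnergyDensity 4 r.ρ x`
(`exists_hasFreeEnergyDensity_holds`, `toReal_partitionFunction_eq_wilsonFinTorusPartition`; second
countability of `G` from the faithful representation). [folklore] -/
theorem stub_tubeRateLimit {G : Type} [Group G] [TopologicalSpace G] [IsTopologicalGroup G] [CompactSpace G]
    [MeasurableSpace G] [BorelSpace G] (r : LatticeRep G) (x : ℝ) (hx : 0 ≤ x) :
    Tendsto (fun L : ℕ => Real.log (transferSpectralRadius r.ρ x (L + 1)) / ((L + 1 : ℕ) : ℝ) ^ 3) atTop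
      (𝓝 (freeEnergyDensity 4 r.ρ x)) := by
  haveI : SecondCountableTopology G :=
    (r.continuous.isClosedEmbedding r.injective).isEmbedding.secondCountableTopology
  -- the torus free energy density exists
  have hf : Tendsto (fun L : ℕ => (((L + 1 : ℕ) : ℝ) ^ 4)⁻¹ * torusLogPartition 4 r.ρ x (L + 1)) atTop
      (𝓝 (freeEnergyDensity 4 r.ρ x)) :=
    hasFreeEnergyDensity_freeEnergyDensity r.ρ (exists_hasFreeEnergyDensity_holds (d := 4) r.ρ r.continuous x)
  -- the bound `72 |x| M / P → 0`
  have hg : Tendsto (fun L : ℕ => 72 * (|x| * costBound r.ρ) / ((L + 1 : ℕ) : ℝ)) atTop (𝓝 0) :=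
    (tendsto_const_div_atTop_nhds_zero_nat (72 * (|x| * costBound r.ρ))).comp (tendsto_add_atTop_nat 1)
  -- the difference of the two sequences tends to zero
  have hdiff : Tendsto (fun L : ℕ => (((L + 1 : ℕ) : ℝ) ^ 4)⁻¹ * torusLogPartition 4 r.ρ x (L + 1) -
      Real.log (transferSpectralRadius r.ρ x (L + 1)) / ((L + 1 : ℕ) : ℝ) ^ 3) atTop (𝓝 0) := by
    refine squeeze_zero_norm' ?_ hg
    filter_upwards [eventually_ge_atTop 1] with L hL
    have hP : 2 ≤ L + 1 := by omega
    have hkey := abs_log_torusPartition_sub_le r hx (L + 1) hP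
    rw [torusLogPartition, toReal_partitionFunction_eq_wilsonFinTorusPartition r.continuous,
      Real.norm_eq_abs]
    have hP0 : (0 : ℝ) < ((L + 1 : ℕ) : ℝ) := by positivity
    set P : ℝ := ((L + 1 : ℕ) : ℝ) with hPdef
    set A : ℝ := Real.log (wilsonFinTorusPartition r.ρ x (L + 1) (L + 1) (L + 1) (L + 1)) with hA
    set B : ℝ := Real.log (transferSpectralRadius r.ρ x (L + 1)) with hB
    have hPne : P ≠ 0 := hP0.ne'
    have hid : (P ^ 4)⁻¹ * A - B / P ^ 3 = (P ^ 4)⁻¹ * (A - P * B) := by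
      field_simp
    rw [hid, abs_mul, abs_inv, abs_of_pos (pow_pos hP0 4)]
    calc (P ^ 4)⁻¹ * |A - P * B| ≤ (P ^ 4)⁻¹ * (72 * (|x| * P ^ 3 * costBound r.ρ)) :=
          mul_le_mul_of_nonneg_left hkey (inv_nonneg.2 (pow_pos hP0 4).le)
      _ = 72 * (|x| * costBound r.ρ) / P := by
          field_simp
  have h := hf.sub hdiff
  rw [sub_zero] at h
  exact h.congr fun L => sub_sub_cancel _ _

end Summit.QuantumFields.YangMills.Theorems.TubeZeroFreeChannel

end
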